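import Summits.CriticalPhenomena.PercolationContinuityZ3.Theorems.PercNearOneGluingNoHeavyLowerTailSahiSymCubeFiveNine
import Summits.CriticalPhenomena.PercolationContinuityZ3.Theorems.PercNearOneGluingNoHeavyLowerTailSahiC4CubeFiveAnyIndex

/-!
# Sahi's `C_n`, `n ≤ 9`, for every product measure on at most five coordinates (any index type, increasing or decreasing events), and
# Sahi's conjecture at EVERY order for five coins ⟸ the order-10 core (the two ten-coloured middle layers)

Support file (cell `prim-sahi`, seat `prim-sahi-typer` gen 29; `--supports stmt-CriticalPhenomena-4575`).  Pure proofs; closure of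
`sahiPositive_bernoulliWeight_all_fin_five_of_core_ten` = that of …`SahiSymCubeFiveNine` (orders `≤ 9` on `{0,1}^5`: standard axioms + the
`native_decide` axioms of the computational chunks of orders `3, …, 9`); the four `|ι| ≤ 5` declarations additionally inherit the 7 `native_decide`
axioms of the `|ι| ≤ 4` all-orders theorem `NCopyCert.sahiPositive_bernoulliWeight_of_card_le_four` (doc correction, typer gen 30; referee R538 (i)).
The order-10 core is discharged in …`SahiSymCubeFiveTen` (typer gen 30).

* `sahiPositive_bernoulliWeight_of_card_le_five_of_le_nine` — `SahiPositive (bernoulliWeight q) n` for every `n ≤ 9` and every `q : ι → [0,1]`,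
  `|ι| ≤ 5` (relabel `ι ≃ Fin 5`, `NCopyCert.bernoulliWeight_eq_pushWeight_congr`; `|ι| ≤ 4`: all orders, `NCopyCert.sahiPositive_bernoulliWeight_of_card_le_four`);
  the order dual `…Dual…` (decreasing events); events forms `sahiE_ind_nonneg_of_isUpperSet/isLowerSet_card_le_five_of_le_nine`;
* **`sahiPositive_bernoulliWeight_all_fin_five_of_core_ten`**.  Typer gen 28 reduced 'all orders on five coins' to six finite coloured-antichain
  conditions (orders `5, …, 10`, `SahiCubeFive.sahiPositive_bernoulliWeight_all_fin_five_of_cores`: value-level saturation with surjective colourings +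
  Sperner width collapse) and certified them OUTSIDE Lean (two engines).  Orders `5, …, 9` are now Lean theorems (…`SahiSymCubeFiveFive` … `FiveNine`),
  so what is left is the order-10 condition alone: `E₁₀(1_{U_0}, …, 1_{U_9}) ≥ 0` under `μ_p` for the families co-generated by the antichains
  `N ⊆ Set (Fin 5)` with a colouring using all ten colours — i.e. (`|N| ≥ 10`, Sperner) `N` = the ten 2-sets or the ten 3-sets, each its own colour:
  TWO polynomial inequalities in `p ∈ [0,1]^5` (both hold coefficientwise by the cell's census, gen 28 §6, two engines; not evaluated in Lean — the
  memoised recursion needs ≈ 5·10⁴ cached numbers of 1.5 MB). [this work]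
-/

namespace Summit.CriticalPhenomena.PercolationContinuityZ3.Theorems.SahiSymCube

open Finset
open Literature.Combinatorics.Sahi2008
open Literature.Probability.Percolation.DecisionTree (ind ind_nonneg)

variable {ι : Type*}

/-! ## Any index type with at most five elements, orders `≤ 9` -/

/-- **`SahiPositive (bernoulliWeight q) n` for every `n ≤ 9` and every product weight on at most five coordinates** (all nonnegative increasing
`f₁, …, f_n` on `Set ι`, `|ι| ≤ 5`). [this work] -/
theorem sahiPositive_bernoulliWeight_of_card_le_five_of_le_nine [Fintype ι] (hι : Fintype.card ι ≤ 5) (q : ι → unitInterval) {n : ℕ}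
    (hn : n ≤ 9) : SahiPositive (bernoulliWeight q) n := by
  classical
  rcases Nat.lt_or_ge (Fintype.card ι) 5 with h | h
  · exact NCopyCert.sahiPositive_bernoulliWeight_of_card_le_four (by omega) q n
  · have hcard : Fintype.card ι = 5 := le_antisymm hι h
    let e : Fin 5 ≃ ι := (finCongr hcard).symm.trans (Fintype.equivFin ι).symm
    rw [NCopyCert.bernoulliWeight_eq_pushWeight_congr e q]
    exact (sahiPositive_bernoulliWeight_fin_five_of_le_nine _ hn).of_pushWeight fun s t hst => Set.image_mono hst

/-- **The order dual** (under which DECREASING events are increasing), orders `≤ 9`, at most five coordinates. [this work] -/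
theorem sahiPositive_bernoulliWeightDual_of_card_le_five_of_le_nine [Fintype ι] (hι : Fintype.card ι ≤ 5) (q : ι → unitInterval) {n : ℕ}
    (hn : n ≤ 9) : SahiPositive (bernoulliWeightDual q) n := by
  rw [NCopyCert.bernoulliWeightDual_eq_pushWeight_compl]
  exact (sahiPositive_bernoulliWeight_of_card_le_five_of_le_nine hι _ hn).of_pushWeight (OrderIso.compl (Set ι)).monotone

/-- **Decreasing events, orders `≤ 9`, at most five coordinates**: `E_n(1_{A_1},…,1_{A_n}) ≥ 0`. [this work] -/
theorem sahiE_ind_nonneg_of_isLowerSet_card_le_five_of_le_nine [Fintype ι] (hι : Fintype.card ι ≤ 5) (q : ι → unitInterval) {n : ℕ}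
    (hn : n ≤ 9) (A : Fin n → Set (Set ι)) (hA : ∀ i, IsLowerSet (A i)) :
    0 ≤ sahiE (bernoulliWeight q) n (fun i => ind (A i)) :=
  sahiPositive_bernoulliWeightDual_of_card_le_five_of_le_nine hι q hn (fun i (a : (Set ι)ᵒᵈ) => ind (A i) (OrderDual.ofDual a))
    (fun _ _ => ind_nonneg _ _) (fun i => monotone_ind_toDual_of_isLowerSet (hA i))

/-- **Increasing events, orders `≤ 9`, at most five coordinates**: `E_n(1_{A_1},…,1_{A_n}) ≥ 0`. [this work] -/
theorem sahiE_ind_nonneg_of_isUpperSet_card_le_five_of_le_nine [Fintype ι] (hι : Fintype.card ι ≤ 5) (q : ι → unitInterval) {n : ℕ}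
    (hn : n ≤ 9) (A : Fin n → Set (Set ι)) (hA : ∀ i, IsUpperSet (A i)) :
    0 ≤ sahiE (bernoulliWeight q) n (fun i => ind (A i)) :=
  sahiPositive_bernoulliWeight_of_card_le_five_of_le_nine hι q hn _ (fun _ _ => ind_nonneg _ _) (fun i => monotone_ind_of_isUpperSet (hA i))

/-! ## All orders on five coins from the order-10 core -/

open scoped Classical in
/-- **SAHI'S CONJECTURE AT EVERY ORDER FOR FIVE INDEPENDENT COINS FROM THE ORDER-10 CORE.**  If `E₁₀ ≥ 0` under `μ_p` for the families co-generated
by the ten-coloured antichains of `Set (Fin 5)` (the two middle layers), then `SahiPositive (bernoulliWeight p) n` for every `n` (orders `≤ 9` are the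
tree's theorems; width collapse above `10`). [this work] -/
theorem sahiPositive_bernoulliWeight_all_fin_five_of_core_ten (p : Fin 5 → unitInterval)
    (h10 : ∀ (N : Finset (Set (Fin 5))) (c : Set (Fin 5) → Fin 10), IsAntichain (· ≤ ·) (N : Set (Set (Fin 5))) →
      (∀ i : Fin 10, ∃ T ∈ N, c T = i) →
      0 ≤ sahiE (bernoulliWeight p) 10 (fun i => setInd (univ.filter fun q : Set (Fin 5) => ∀ T ∈ N, c T = i → ¬ q ≤ T))) :
    ∀ n, SahiPositive (bernoulliWeight p) n := by
  refine SahiCubeFive.sahiPositive_bernoulliWeight_all_fin_five_of_cores p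
    (fun n hn => sahiPositive_bernoulliWeight_fin_five_of_le_nine p (by omega)) fun n h3 h8 N c hN hsurj => ?_
  by_cases h9 : n + 2 ≤ 9
  · exact sahiPositive_bernoulliWeight_fin_five_of_le_nine p h9 _ (fun _ _ => setInd_nonneg _ _)
      (fun i => monotone_setInd (SahiAbsorbed.isUpperSet_filter_coMember N c i))
  · obtain rfl : n = 8 := by omega
    exact h10 N c hN hsurj

end Summit.CriticalPhenomena.PercolationContinuityZ3.Theorems.SahiSymCube
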